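import Summits.ABC.StewartYu.ArchG3RecA
import HarnessLib

/-!
# The archimedean record of reference `ArchG3Rec` — the schedule LETTERS consumed by the line's packs (v4 cut)

Support file (plain definitions + elementary theorems; no named facts). Cell `abc-stewartyu`, route `YuMatveevShapeRat`,
crux r2 `ArchCoreRat` (stmt-ABC-20502); seat p1 (record owner). Names fixed for p4's `ArchG3Line.StartAt`/`EndAt` and
p5's `PackInputs` (STATUS p4 18:37:49Z «confirm names from ArchG3Rec/RecA»): per level `s` and stage `ν`
* nodes `Nf s ν = 2^ν·Xs s` (so `𝒳_{s,ν} = {|x| ≤ Nf s ν}`), odd half-level bound `Nh s = Xs s`, orders `Tf s ν = Mord s ν`;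
* the slab: width `wl s = L·e^{−(G+2)}/2^s` (halved per level) and centre bound `γb 0 = n·L/2 + wl 0`,
  `γb (s+1) = wl s/2` (after the half-step the class is re-centred at `0`, lp-1's `halfDiff`);
* the α-box half-sides `σ j = L/(2 A j)` (real) and the VIRTUAL integer box `Bv j = ⌊N·σ j⌋₊` (`|ν(μ)ⱼ| ≤ Bv j` for the
  unknowns' virtual coordinates `ν(μ) = μ ᵥ* U = N·λ`); `1 ≤ Bv j` by the harmless floor `2A_max/N < L`.
Facts: `wl_succ`, `γb_succ`/`γb_zero`, `Nf_succ_le` (`Nf s (ν+1) ≤ 3·Nf s ν + 2`, lp-1's `N' ≤ 3N+2`), `two_Nh_succ_le`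
(`2·Nh (s+1) ≤ 6·Nf s n + 5`, the half-step's node law, from `Xs (s+1) ≤ 2·Xs s`… stated as `Xs_succ_le_two_mul`),
`σ_facts`, `Bv_facts`.

## References
* [Nesterenko2003] Yu. V. Nesterenko, LNM 1819 (2003) — §4 (4.3)–(4.5) (nodes/orders), §3.3 (the slab), §3.5 (3.12) (the box).
* [Matveev2000] E. M. Matveev, Izv. Math. 64 (2000) — §3 (the slab).
-/

noncomputable section

open Finset Real

namespace Summit.ABC.StewartYu

namespace ArchG3Rec

open PadicG3Par (cG cM Cb cG_pos Cb_pos)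
open ArchG3Par (G K SdK yloadK G_eq eight_le_G G_pos one_le_K K_pos two_G_le_yloadK yloadK_pos)

variable {n : ℕ} (P : ArchG3Rec n)

/-! ### Nodes and orders -/

/-- the node bound at stage `(s, ν)`: `Nf s ν = 2^ν · Xs s`. [cite: Nesterenko2003, §4 (𝒳_{s,ν})] -/
def Nf (s ν : ℕ) : ℕ := 2 ^ ν * P.Xs s

/-- the odd half-level node bound `Nh s = Xs s` (`𝒳_{s,0} = {odd x, |x| ≤ 2·Nh s − 1}`). [cite: Nesterenko2003, §4 (𝒳_{s,0})] -/
def Nh (s : ℕ) : ℕ := P.Xs s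

/-- the order letter at stage `(s, ν)`: `Tf s ν = Mord s ν`. [cite: Nesterenko2003, (4.5)] -/
def Tf (s ν : ℕ) : ℕ := P.Mord s ν

/-! ### The slab -/

/-- the slab half-width at level `s`: `wl s = L·e^{−(G+2)}/2^s`. [cite: Matveev2000, §3; shape only] -/
def wl (s : ℕ) : ℝ := (P.L : ℝ) * Real.exp (-(G n + 2)) / 2 ^ s

/-- the slab-centre bound: `γb 0 = n·L/2 + wl 0` (a pigeonhole class of `λ ↦ Σ λⱼ log αⱼ` on the box, `|Σ| ≤ nL/2`),
`γb (s+1) = wl s / 2` (re-centred at `0` after each half-step). [cite: Matveev2000, §3; shape only] -/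
def γb : ℕ → ℝ
  | 0 => (n : ℝ) * P.L / 2 + P.wl 0
  | s + 1 => P.wl s / 2

/-! ### The box -/

/-- the real α-box half-sides `σ j = L/(2 A j)`. [cite: Nesterenko2003, §3.5 (3.12)] -/
def σ (j : Fin n) : ℝ := (P.L : ℝ) / (2 * P.A j)

/-- the VIRTUAL integer box `Bv j = ⌊N·σ j⌋₊` (bounds `|ν(μ)ⱼ|`, `ν(μ) = μ ᵥ* U = N·λ`). [cite: Nesterenko2003, §3.4–3.5; shape only] -/
def Bv (j : Fin n) : ℕ := ⌊(P.N : ℝ) * P.σ j⌋₊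

/-! ### Facts -/

/-- halving of the width: `wl (s+1) = wl s / 2`, and `0 < wl s`. [folklore] -/
theorem wl_facts (s : ℕ) : P.wl (s + 1) = P.wl s / 2 ∧ 0 < P.wl s := by
  have hL := P.L_real.2.1
  refine ⟨?_, by unfold wl; positivity⟩
  unfold wl; rw [pow_succ]; field_simp

/-- the centre bounds: `γb 0 = nL/2 + wl 0`, `γb (s+1) = wl s/2`, hence `wl s / 2 ≤ γb (s+1)` and `0 < γb s`. [folklore] -/
theorem γb_facts (s : ℕ) : P.γb 0 = (n : ℝ) * P.L / 2 + P.wl 0 ∧ P.γb (s + 1) = P.wl s / 2 ∧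
    P.wl s / 2 ≤ P.γb (s + 1) ∧ 0 < P.γb s := by
  refine ⟨rfl, rfl, le_of_eq rfl, ?_⟩
  cases s with
  | zero =>
    have h := (P.wl_facts 0).2
    have hL := P.L_real.2.1
    have hn : (0 : ℝ) ≤ n := Nat.cast_nonneg n
    show 0 < (n : ℝ) * P.L / 2 + P.wl 0
    positivity
  | succ s =>
    have h := (P.wl_facts s).2
    show 0 < P.wl s / 2
    positivity

/-- the node laws: `Nf s (ν+1) = 2·Nf s ν ≤ 3·Nf s ν + 2` (lp-1's `N′ ≤ 3N + 2`) and `Nf s 0 = Xs s = Nh s`. [folklore] -/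
theorem Nf_facts (s ν : ℕ) : P.Nf s (ν + 1) = 2 * P.Nf s ν ∧ P.Nf s (ν + 1) ≤ 3 * P.Nf s ν + 2 ∧
    P.Nf s 0 = P.Nh s := by
  refine ⟨by unfold Nf; rw [pow_succ]; ring, by unfold Nf; rw [pow_succ]; nlinarith [Nat.zero_le (2 ^ ν * P.Xs s)],
    by unfold Nf Nh; simp⟩

/-- **`Xs (s+1) ≤ 2·Xs s`** (both cap branches: `⌊2x⌋ ≤ 2⌊x⌋ + 1`; `4XL/(T(s+1)+1) ≤ 2·(4XL/(T s+1)) + 1` as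
`T s + 1 ≤ 2·(T (s+1) + 1)`). [cite: Nesterenko2003, (4.3)] -/
theorem Xs_succ_le_two_mul (s : ℕ) : P.Xs (s + 1) ≤ 2 * P.Xs s := by
  -- the order drops: `T s + 1 ≤ 2 (T (s+1) + 1)`
  have hT : P.T s + 1 ≤ 2 * (P.T (s + 1) + 1) := by
    unfold T
    have h1 : 8 * P.L / 2 ^ s ≤ 2 * (8 * P.L / 2 ^ (s + 1)) + 1 := by
      have e : 2 ^ (s + 1) = 2 ^ s * 2 := pow_succ 2 s
      rw [e, ← Nat.div_div_eq_div_mul]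
      have := Nat.lt_div_mul_add (a := 8 * P.L / 2 ^ s) (b := 2) (by norm_num)
      omega
    have hm1 : 1 ≤ max 1 (8 * P.L / 2 ^ (s + 1)) := le_max_left _ _
    have hm2 : 8 * P.L / 2 ^ (s + 1) ≤ max 1 (8 * P.L / 2 ^ (s + 1)) := le_max_right _ _
    rcases max_choice 1 (8 * P.L / 2 ^ s) with h | h <;> rw [h] <;> omega
  -- the doubling cap: `⌊2x⌋₊ + 1 ≤ 2 (⌊x⌋₊ + 1)`
  have hA : ⌊(2 : ℝ) ^ (s + 1) * G n * P.X / (16 * (n + 1))⌋₊ + 1 ≤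
      2 * (⌊(2 : ℝ) ^ s * G n * P.X / (16 * (n + 1))⌋₊ + 1) := by
    have hr : 0 ≤ (2 : ℝ) ^ s * G n * P.X / (16 * (n + 1)) := by have := G_pos n; positivity
    have e : (2 : ℝ) ^ (s + 1) * G n * P.X / (16 * (n + 1)) = 2 * ((2 : ℝ) ^ s * G n * P.X / (16 * (n + 1))) := by
      rw [pow_succ]; ring
    rw [e]
    have h2 := Nat.lt_floor_add_one ((2 : ℝ) ^ s * G n * P.X / (16 * (n + 1)))
    have h3 : (⌊2 * ((2 : ℝ) ^ s * G n * P.X / (16 * (n + 1)))⌋₊ : ℝ) <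
        2 * (⌊(2 : ℝ) ^ s * G n * P.X / (16 * (n + 1))⌋₊ : ℝ) + 2 := by
      have := Nat.floor_le (show 0 ≤ 2 * ((2 : ℝ) ^ s * G n * P.X / (16 * (n + 1))) by positivity)
      linarith
    have h4 : ⌊2 * ((2 : ℝ) ^ s * G n * P.X / (16 * (n + 1)))⌋₊ < 2 * ⌊(2 : ℝ) ^ s * G n * P.X / (16 * (n + 1))⌋₊ + 2 := by
      exact_mod_cast h3
    omega
  -- the print cap: `a/c' + 1 ≤ 2 (a/c + 1)` when `c ≤ 2 c'`
  have hB : 4 * P.X * P.L / (P.T (s + 1) + 1) + 1 ≤ 2 * (4 * P.X * P.L / (P.T s + 1) + 1) := by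
    have hc : 0 < P.T (s + 1) + 1 := by omega
    have h4 := Nat.lt_div_mul_add (a := 4 * P.X * P.L) (b := P.T s + 1) (by omega)
    have h5 : 4 * P.X * P.L < (2 * (4 * P.X * P.L / (P.T s + 1)) + 2) * (P.T (s + 1) + 1) := by
      calc 4 * P.X * P.L < (4 * P.X * P.L / (P.T s + 1) + 1) * (P.T s + 1) := by linarith
        _ ≤ (4 * P.X * P.L / (P.T s + 1) + 1) * (2 * (P.T (s + 1) + 1)) := Nat.mul_le_mul_left _ hT
        _ = (2 * (4 * P.X * P.L / (P.T s + 1)) + 2) * (P.T (s + 1) + 1) := by ring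
    have h6 : 4 * P.X * P.L / (P.T (s + 1) + 1) < 2 * (4 * P.X * P.L / (P.T s + 1)) + 2 :=
      (Nat.div_lt_iff_lt_mul hc).mpr h5
    omega
  unfold Xs
  rcases min_choice (⌊(2 : ℝ) ^ s * G n * P.X / (16 * (n + 1))⌋₊ + 1) (4 * P.X * P.L / (P.T s + 1) + 1) with h | h
  · rw [h]; exact (min_le_left _ _).trans hA
  · rw [h]; exact (min_le_right _ _).trans hB

/-- the half-step node law: `2·Nh (s+1) ≤ 6·Nf s n + 5` (indeed `≤ 4·Nf s n`). [folklore] -/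
theorem two_Nh_succ_le (s : ℕ) : 2 * P.Nh (s + 1) ≤ 6 * P.Nf s n + 5 := by
  unfold Nh Nf
  have h := P.Xs_succ_le_two_mul s
  have h1 : P.Xs s ≤ 2 ^ n * P.Xs s := Nat.le_mul_of_pos_left _ (Nat.two_pow_pos n)
  omega

/-- the box: `0 < σ j`, `σ j ≤ L/2`, `1/N < σ j / A_max·A_max`… concretely `(1 : ℝ) < N·σ j` (from `2A_max/N < L`,
`A j ≤ A_max`), hence `1 ≤ Bv j` and `Bv j ≤ N·σ j`. [folklore] -/
theorem box_facts (j : Fin n) : 0 < P.σ j ∧ (1 : ℝ) < P.N * P.σ j ∧ 1 ≤ P.Bv j ∧ (P.Bv j : ℝ) ≤ P.N * P.σ j := by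
  obtain ⟨hA0, -, hAm⟩ := P.A_facts j
  obtain ⟨hN0, -, -⟩ := P.N_facts
  obtain ⟨-, hL0, -, hfl⟩ := P.L_real
  have hσ : 0 < P.σ j := by unfold σ; positivity
  have h1 : (1 : ℝ) < P.N * P.σ j := by
    unfold σ
    rw [div_lt_iff₀ hN0] at hfl
    rw [mul_div_assoc', lt_div_iff₀ (by positivity)]
    nlinarith
  refine ⟨hσ, h1, ?_, Nat.floor_le (by positivity)⟩
  unfold Bv
  exact Nat.one_le_floor_iff _ |>.mpr h1.le |> fun h => by exact_mod_cast h

end ArchG3Rec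

end Summit.ABC.StewartYu
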